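import Summits.Ventures.CertifiedManyBodySolver.Theorems.ThermalStiffnessCeilingU8b8_le_7o44.Negative.CanonicalDensityCounting
import Summits.Ventures.CertifiedManyBodySolver.Theorems.TcThermcert1FarCutGeometry
import Summits.Ventures.CertifiedManyBodySolver.Theorems.TcThermcert1FarCutAsymptotics
import Literature.MathematicalPhysics.QuantumLattice.FermionEmbedLocality
import HarnessLib

/-!
# The density-clustering strengthening of Hypothesis C is false at `β = 0` (canonical density plateau on the torus)
(negative-side lemma for the crux K1′ of route `TcThermcert1`)

Disprover's lemma (`--supports stmt-Ventures-24560`; crux K1′ `TcThermcert1.ThermalStiffnessCeilingU8b8_le_7o44`, line of record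
`Cruxes/ThermalStiffnessCeilingU8b8_le_7o44/Lines/gauge_qbp_far_seam.lean` v1.4, bet C8 `stub_currentClustering8 : ∃ ξ, CurrentClustering
8 (7/8) 8 ξ`): finding F6 of edition 3 of `Cruxes/ThermalStiffnessCeilingU8b8_le_7o44/Disproof.lean`, over the tree's literal operators.

The line's Hypothesis C asks for exponential clustering `|ω(A j) - ω(A) ω(j)| ≤ C ‖A‖ |X|^k e^{-d/ξ}` of the covariance of a
sector-preserving even observable `A ∈ 𝔄(X)` with the bond CURRENT `j` across a far bond, in the canonical `(N↑, N↓) = (7q², 7q²)`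
sector state of the `L = 4q` torus; its docstring says it is «deliberately NOT stated for a general second observable B». This file
prices that clause: with `j_{(X₀,y)}` replaced by the DENSITY `n_{(X₀,y),↑}` at the bond's head (everything else verbatim), the
statement is FALSE for every `U` and every `ξ` already at `β = 0` (`not_densityClusteringBody_7o8_beta_zero`), because the
canonical state carries the exact Lebowitz–Percus–Verlet plateau `|Cov(n_{x↑}, n_{a↑})| = 63 / (256 (16q² - 1))` at ALL distances
(`norm_densityCov_sector7o8_eq`, from `CanonicalDensityCounting.lean`), which beats `C e^{-q/ξ}` along `d = q → ∞`.
CONTRAST: with the current as partner the same `β = 0` covariance is identically `0` (`CurrentCovarianceLocality.lean`, F4) — the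
zero-diagonal / time-reversal-odd structure of `j` is exactly what any proof of C8 has to exploit at every order; a proof strategy
that would equally give density clustering in the canonical sector state is refuted by this file.

HONEST FRAMING: finite-dimensional folklore; NO KILL of K1′, of stub B or of the bet C8 is claimed (the refuted statement is a
modification of Hypothesis C that no registered plan uses), and superconductivity in the Hubbard model is neither proved nor
disproved by anything in this file.
-/

noncomputable section

open scoped ComplexOrder ComplexConjugate Matrix.Norms.L2Operator
open Filter Topology Matrix Finset
open Literature.MathematicalPhysics.QuantumLattice
open Literature.Probability.LatticeModels
open Summit.Ventures.CertifiedManyBodySolver.Theorems.TcThermcert1.GaugeQbpFarSeam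
open Summit.Ventures.CertifiedManyBodySolver.Theorems.TcThermcert1.CurrentCovarianceNonVacuity

namespace Summit.Ventures.CertifiedManyBodySolver.Theorems.TcThermcert1.CanonicalDensityPlateau

/-! ## The bet's sector on the tori `L = 4q`: the exact plateau against the far bond's head density, and the refutation -/

section Torus

/-- **The plateau at the bet's density.** On the torus `L = 4q` (`q ≥ 1`), in the line's sector `sectorPred (4q) (1 - 7/8)`
(`(N↑, N↓) = (7q², 7q²)`, `|Λ| = 16q²`) at `β = 0`, the covariance of the spin-`↑` density at the collar site `(0,0)` with the
spin-`↑` density at the head `(L/2, 0)` of a bond of the ANTIPODAL cut has modulus EXACTLY `63 / (256 (16q² - 1))` — a `1/|Λ|`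
plateau, not `e^{-dist/ξ}`. [cite: LebowitzPercusVerlet1967, §II; folklore] -/
theorem norm_densityCov_sector7o8_eq (q : ℕ) (hq : 1 ≤ q) [NeZero (4 * q)] (U : ℝ) :
    ‖gibbsState 0 ((hubbardTorusTT'Flux (4 * q) 0 U 0).toBlock
          (fun s => s.card = 2 * ⌊(1 - (1 - 7 / 8 : ℝ)) * ((4 * q : ℕ) : ℝ) ^ 2 / 2⌋₊ ∧
            2 * (s.filter fun i => (ofLex i).2 = 0).card = 2 * ⌊(1 - (1 - 7 / 8 : ℝ)) * ((4 * q : ℕ) : ℝ) ^ 2 / 2⌋₊)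
          (fun s => s.card = 2 * ⌊(1 - (1 - 7 / 8 : ℝ)) * ((4 * q : ℕ) : ℝ) ^ 2 / 2⌋₊ ∧
            2 * (s.filter fun i => (ofLex i).2 = 0).card = 2 * ⌊(1 - (1 - 7 / 8 : ℝ)) * ((4 * q : ℕ) : ℝ) ^ 2 / 2⌋₊))
        ((numberOp (FermionTorus.ofTorusSite (![0, 0] : TorusSite 2 (4 * q))) 0 *
            numberOp (FermionTorus.ofTorusSite (![(((4 * q) / 2 : ℕ) : ZMod (4 * q)), 0] : TorusSite 2 (4 * q))) 0).toBlock
          (fun s => s.card = 2 * ⌊(1 - (1 - 7 / 8 : ℝ)) * ((4 * q : ℕ) : ℝ) ^ 2 / 2⌋₊ ∧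
            2 * (s.filter fun i => (ofLex i).2 = 0).card = 2 * ⌊(1 - (1 - 7 / 8 : ℝ)) * ((4 * q : ℕ) : ℝ) ^ 2 / 2⌋₊)
          (fun s => s.card = 2 * ⌊(1 - (1 - 7 / 8 : ℝ)) * ((4 * q : ℕ) : ℝ) ^ 2 / 2⌋₊ ∧
            2 * (s.filter fun i => (ofLex i).2 = 0).card = 2 * ⌊(1 - (1 - 7 / 8 : ℝ)) * ((4 * q : ℕ) : ℝ) ^ 2 / 2⌋₊))
      - gibbsState 0 ((hubbardTorusTT'Flux (4 * q) 0 U 0).toBlock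
          (fun s => s.card = 2 * ⌊(1 - (1 - 7 / 8 : ℝ)) * ((4 * q : ℕ) : ℝ) ^ 2 / 2⌋₊ ∧
            2 * (s.filter fun i => (ofLex i).2 = 0).card = 2 * ⌊(1 - (1 - 7 / 8 : ℝ)) * ((4 * q : ℕ) : ℝ) ^ 2 / 2⌋₊)
          (fun s => s.card = 2 * ⌊(1 - (1 - 7 / 8 : ℝ)) * ((4 * q : ℕ) : ℝ) ^ 2 / 2⌋₊ ∧
            2 * (s.filter fun i => (ofLex i).2 = 0).card = 2 * ⌊(1 - (1 - 7 / 8 : ℝ)) * ((4 * q : ℕ) : ℝ) ^ 2 / 2⌋₊))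
        ((numberOp (FermionTorus.ofTorusSite (![0, 0] : TorusSite 2 (4 * q))) 0).toBlock
          (fun s => s.card = 2 * ⌊(1 - (1 - 7 / 8 : ℝ)) * ((4 * q : ℕ) : ℝ) ^ 2 / 2⌋₊ ∧
            2 * (s.filter fun i => (ofLex i).2 = 0).card = 2 * ⌊(1 - (1 - 7 / 8 : ℝ)) * ((4 * q : ℕ) : ℝ) ^ 2 / 2⌋₊)
          (fun s => s.card = 2 * ⌊(1 - (1 - 7 / 8 : ℝ)) * ((4 * q : ℕ) : ℝ) ^ 2 / 2⌋₊ ∧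
            2 * (s.filter fun i => (ofLex i).2 = 0).card = 2 * ⌊(1 - (1 - 7 / 8 : ℝ)) * ((4 * q : ℕ) : ℝ) ^ 2 / 2⌋₊))
        * gibbsState 0 ((hubbardTorusTT'Flux (4 * q) 0 U 0).toBlock
          (fun s => s.card = 2 * ⌊(1 - (1 - 7 / 8 : ℝ)) * ((4 * q : ℕ) : ℝ) ^ 2 / 2⌋₊ ∧
            2 * (s.filter fun i => (ofLex i).2 = 0).card = 2 * ⌊(1 - (1 - 7 / 8 : ℝ)) * ((4 * q : ℕ) : ℝ) ^ 2 / 2⌋₊)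
          (fun s => s.card = 2 * ⌊(1 - (1 - 7 / 8 : ℝ)) * ((4 * q : ℕ) : ℝ) ^ 2 / 2⌋₊ ∧
            2 * (s.filter fun i => (ofLex i).2 = 0).card = 2 * ⌊(1 - (1 - 7 / 8 : ℝ)) * ((4 * q : ℕ) : ℝ) ^ 2 / 2⌋₊))
        ((numberOp (FermionTorus.ofTorusSite (![(((4 * q) / 2 : ℕ) : ZMod (4 * q)), 0] : TorusSite 2 (4 * q))) 0).toBlock
          (fun s => s.card = 2 * ⌊(1 - (1 - 7 / 8 : ℝ)) * ((4 * q : ℕ) : ℝ) ^ 2 / 2⌋₊ ∧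
            2 * (s.filter fun i => (ofLex i).2 = 0).card = 2 * ⌊(1 - (1 - 7 / 8 : ℝ)) * ((4 * q : ℕ) : ℝ) ^ 2 / 2⌋₊)
          (fun s => s.card = 2 * ⌊(1 - (1 - 7 / 8 : ℝ)) * ((4 * q : ℕ) : ℝ) ^ 2 / 2⌋₊ ∧
            2 * (s.filter fun i => (ofLex i).2 = 0).card = 2 * ⌊(1 - (1 - 7 / 8 : ℝ)) * ((4 * q : ℕ) : ℝ) ^ 2 / 2⌋₊))‖
      = 63 / (256 * (16 * (q : ℝ) ^ 2 - 1)) := by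
  have hM : ⌊(1 - (1 - 7 / 8 : ℝ)) * ((4 * q : ℕ) : ℝ) ^ 2 / 2⌋₊ = 7 * q ^ 2 := by
    have h : (1 - (1 - 7 / 8 : ℝ)) * ((4 * q : ℕ) : ℝ) ^ 2 / 2 = ((7 * q ^ 2 : ℕ) : ℝ) := by push_cast; ring
    rw [h, Nat.floor_natCast]
  have hcard : Fintype.card (FermionTorus 2 (4 * q)) = (4 * q) ^ 2 := by
    rw [Fintype.card_lex, Fintype.card_fun, Fintype.card_fin, Fintype.card_fin]
  have h16 : (4 * q) ^ 2 = 16 * q ^ 2 := by ring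
  have hq2 : 1 ≤ q ^ 2 := Nat.one_le_pow 2 q hq
  have hxa : FermionTorus.ofTorusSite (![(((4 * q) / 2 : ℕ) : ZMod (4 * q)), 0] : TorusSite 2 (4 * q)) ≠
      FermionTorus.ofTorusSite (![0, 0] : TorusSite 2 (4 * q)) := by
    intro h
    have h' := congrArg FermionTorus.toTorusSite h
    rw [FermionTorus.toTorusSite_ofTorusSite, FermionTorus.toTorusSite_ofTorusSite] at h'
    have h1 := congrArg ZMod.val (congrFun h' 0)
    simp only [Matrix.cons_val_zero, ZMod.val_zero] at h1
    rw [ZMod.val_cast_of_lt (by omega)] at h1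
    omega
  have hne : ∃ s : Finset (Orb (FermionTorus 2 (4 * q))),
      s.card = 2 * ⌊(1 - (1 - 7 / 8 : ℝ)) * ((4 * q : ℕ) : ℝ) ^ 2 / 2⌋₊ ∧
        2 * (s.filter fun i => (ofLex i).2 = 0).card = 2 * ⌊(1 - (1 - 7 / 8 : ℝ)) * ((4 * q : ℕ) : ℝ) ^ 2 / 2⌋₊ := by
    obtain ⟨S, T, hS, -, -⟩ := exists_sector_farBond_apply_ne_zero hxa
      (M := ⌊(1 - (1 - 7 / 8 : ℝ)) * ((4 * q : ℕ) : ℝ) ^ 2 / 2⌋₊) (by rw [hM]; omega)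
      (by rw [hM, hcard, h16]; omega)
    exact ⟨S, hS⟩
  have hV : 2 ≤ Fintype.card (FermionTorus 2 (4 * q)) := by
    rw [hcard, h16]
    omega
  have hcov := densityCov_sector_beta_zero_eq (Λ := FermionTorus 2 (4 * q))
    ⌊(1 - (1 - 7 / 8 : ℝ)) * ((4 * q : ℕ) : ℝ) ^ 2 / 2⌋₊ hne hV hxa (hubbardTorusTT'Flux (4 * q) 0 U 0)
  rw [hcov, Complex.norm_real, Real.norm_eq_abs, hM, hcard, h16]
  have hq1 : (1 : ℝ) ≤ q := by exact_mod_cast hq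
  have hden : (0 : ℝ) < 16 * (q : ℝ) ^ 2 - 1 := by nlinarith
  have hqr : (q : ℝ) ≠ 0 := Nat.cast_ne_zero.2 (by omega)
  have hnum : (0 : ℝ) ≤ ((7 * q ^ 2 : ℕ) : ℝ) * (((16 * q ^ 2 : ℕ) : ℝ) - ((7 * q ^ 2 : ℕ) : ℝ)) := by
    push_cast
    nlinarith
  have hden' : (0 : ℝ) < (((16 * q ^ 2 : ℕ) : ℝ)) ^ 2 * (((16 * q ^ 2 : ℕ) : ℝ) - 1) := by
    push_cast
    exact mul_pos (by positivity) hden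
  have hden0 : 16 * (q : ℝ) ^ 2 - 1 ≠ 0 := hden.ne'
  rw [abs_div, abs_neg, abs_of_nonneg hnum, abs_of_pos hden']
  push_cast
  field_simp
  ring

/-- **The density-clustering strengthening of the bet is FALSE at `β = 0`.** The line's Hypothesis C
`CurrentClustering U (7/8) β ξ` with the bond current `j_{(X₀,y)}` replaced by the density `n_{(X₀,y),↑}` at the bond's
head (unfolded below; `DensityClustering U (7/8) 0 ξ` of edition 3 of the crux work file, checked `Iff.rfl`-equal there)
fails for every `U` and `ξ` already at infinite temperature: take `L = 4q`, `X = {(0,0)}`, `A = n_{(0,0),↑}` (even, in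
`𝔄(orbSet X)`, norm `≤ 1`, sector preserving), the antipodal cut `X₀ = L/2`, `y = 0`, `d = q ≤ L/2 - 1`
(`farBond_dist_of_mem_collar`); the left side is the plateau `63/(256(16q²-1))` (`norm_densityCov_sector7o8_eq`), the right
side `C e^{-q/ξ}`, and `q² e^{-q/ξ} → 0`. READING: canonical (fixed `N↑, N↓`) sector states carry `O(1/|Λ|)`
Lebowitz–Percus–Verlet corrections that do not decay with distance; Hypothesis C can only hold because its partner, the
bond current, has zero diagonal / zero density-derivative (`CurrentCovarianceLocality`, `CurrentCovarianceTRBlind`) —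
the line's clause «deliberately NOT stated for a general second observable B» is load-bearing, not cosmetic.
[cite: LebowitzPercusVerlet1967, §II; folklore] -/
theorem not_densityClusteringBody_7o8_beta_zero (U ξ : ℝ) :
    ¬ (0 < ξ ∧ ∃ C : ℝ, ∃ k L₀ : ℕ, ∀ (L : ℕ) [NeZero L], L₀ ≤ L →
      ∀ (X : Finset (FermionTorus 2 L)) (A : Matrix (Finset (Orb (FermionTorus 2 L))) (Finset (Orb (FermionTorus 2 L))) ℂ),
        A ∈ carEvenSubalgebra (orbSet X) →
        (∀ s t : Finset (Orb (FermionTorus 2 L)),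
          (s.card = 2 * ⌊(1 - (1 - 7 / 8 : ℝ)) * (L : ℝ) ^ 2 / 2⌋₊ ∧
            2 * (s.filter fun i => (ofLex i).2 = 0).card = 2 * ⌊(1 - (1 - 7 / 8 : ℝ)) * (L : ℝ) ^ 2 / 2⌋₊) →
          ¬ (t.card = 2 * ⌊(1 - (1 - 7 / 8 : ℝ)) * (L : ℝ) ^ 2 / 2⌋₊ ∧
            2 * (t.filter fun i => (ofLex i).2 = 0).card = 2 * ⌊(1 - (1 - 7 / 8 : ℝ)) * (L : ℝ) ^ 2 / 2⌋₊) →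
          A s t = 0 ∧ A t s = 0) →
        ∀ (X₀ y : ZMod L) (d : ℕ),
          (∀ x ∈ X, d ≤ torusDist x.toTorusSite ![X₀, y] ∧
            d ≤ torusDist x.toTorusSite ![X₀ - 1, y]) →
          ‖gibbsState 0 ((hubbardTorusTT'Flux L 0 U 0).toBlock
                (fun s => s.card = 2 * ⌊(1 - (1 - 7 / 8 : ℝ)) * (L : ℝ) ^ 2 / 2⌋₊ ∧
                  2 * (s.filter fun i => (ofLex i).2 = 0).card = 2 * ⌊(1 - (1 - 7 / 8 : ℝ)) * (L : ℝ) ^ 2 / 2⌋₊)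
                (fun s => s.card = 2 * ⌊(1 - (1 - 7 / 8 : ℝ)) * (L : ℝ) ^ 2 / 2⌋₊ ∧
                  2 * (s.filter fun i => (ofLex i).2 = 0).card = 2 * ⌊(1 - (1 - 7 / 8 : ℝ)) * (L : ℝ) ^ 2 / 2⌋₊))
              ((A * numberOp (FermionTorus.ofTorusSite (![X₀, y] : TorusSite 2 L)) 0).toBlock
                (fun s => s.card = 2 * ⌊(1 - (1 - 7 / 8 : ℝ)) * (L : ℝ) ^ 2 / 2⌋₊ ∧
                  2 * (s.filter fun i => (ofLex i).2 = 0).card = 2 * ⌊(1 - (1 - 7 / 8 : ℝ)) * (L : ℝ) ^ 2 / 2⌋₊)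
                (fun s => s.card = 2 * ⌊(1 - (1 - 7 / 8 : ℝ)) * (L : ℝ) ^ 2 / 2⌋₊ ∧
                  2 * (s.filter fun i => (ofLex i).2 = 0).card = 2 * ⌊(1 - (1 - 7 / 8 : ℝ)) * (L : ℝ) ^ 2 / 2⌋₊))
            - gibbsState 0 ((hubbardTorusTT'Flux L 0 U 0).toBlock
                (fun s => s.card = 2 * ⌊(1 - (1 - 7 / 8 : ℝ)) * (L : ℝ) ^ 2 / 2⌋₊ ∧
                  2 * (s.filter fun i => (ofLex i).2 = 0).card = 2 * ⌊(1 - (1 - 7 / 8 : ℝ)) * (L : ℝ) ^ 2 / 2⌋₊)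
                (fun s => s.card = 2 * ⌊(1 - (1 - 7 / 8 : ℝ)) * (L : ℝ) ^ 2 / 2⌋₊ ∧
                  2 * (s.filter fun i => (ofLex i).2 = 0).card = 2 * ⌊(1 - (1 - 7 / 8 : ℝ)) * (L : ℝ) ^ 2 / 2⌋₊))
              (A.toBlock
                (fun s => s.card = 2 * ⌊(1 - (1 - 7 / 8 : ℝ)) * (L : ℝ) ^ 2 / 2⌋₊ ∧
                  2 * (s.filter fun i => (ofLex i).2 = 0).card = 2 * ⌊(1 - (1 - 7 / 8 : ℝ)) * (L : ℝ) ^ 2 / 2⌋₊)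
                (fun s => s.card = 2 * ⌊(1 - (1 - 7 / 8 : ℝ)) * (L : ℝ) ^ 2 / 2⌋₊ ∧
                  2 * (s.filter fun i => (ofLex i).2 = 0).card = 2 * ⌊(1 - (1 - 7 / 8 : ℝ)) * (L : ℝ) ^ 2 / 2⌋₊))
              * gibbsState 0 ((hubbardTorusTT'Flux L 0 U 0).toBlock
                (fun s => s.card = 2 * ⌊(1 - (1 - 7 / 8 : ℝ)) * (L : ℝ) ^ 2 / 2⌋₊ ∧
                  2 * (s.filter fun i => (ofLex i).2 = 0).card = 2 * ⌊(1 - (1 - 7 / 8 : ℝ)) * (L : ℝ) ^ 2 / 2⌋₊)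
                (fun s => s.card = 2 * ⌊(1 - (1 - 7 / 8 : ℝ)) * (L : ℝ) ^ 2 / 2⌋₊ ∧
                  2 * (s.filter fun i => (ofLex i).2 = 0).card = 2 * ⌊(1 - (1 - 7 / 8 : ℝ)) * (L : ℝ) ^ 2 / 2⌋₊))
              ((numberOp (FermionTorus.ofTorusSite (![X₀, y] : TorusSite 2 L)) 0).toBlock
                (fun s => s.card = 2 * ⌊(1 - (1 - 7 / 8 : ℝ)) * (L : ℝ) ^ 2 / 2⌋₊ ∧
                  2 * (s.filter fun i => (ofLex i).2 = 0).card = 2 * ⌊(1 - (1 - 7 / 8 : ℝ)) * (L : ℝ) ^ 2 / 2⌋₊)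
                (fun s => s.card = 2 * ⌊(1 - (1 - 7 / 8 : ℝ)) * (L : ℝ) ^ 2 / 2⌋₊ ∧
                  2 * (s.filter fun i => (ofLex i).2 = 0).card = 2 * ⌊(1 - (1 - 7 / 8 : ℝ)) * (L : ℝ) ^ 2 / 2⌋₊))‖
            ≤ C * ‖A‖ * (X.card : ℝ) ^ k * Real.exp (-(d : ℝ) / ξ)) := by
  rintro ⟨hξ, C, k, L₀, h⟩
  have key : ∀ q : ℕ, L₀ + 1 ≤ q → (1 : ℝ) ≤ |C| * 4096 / 63 * (q : ℝ) ^ 2 * Real.exp (-(1 / ξ * q)) := by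
    intro q hq
    haveI : NeZero (4 * q) := ⟨by omega⟩
    have hA : numberOp (FermionTorus.ofTorusSite (![0, 0] : TorusSite 2 (4 * q))) 0 ∈
        carEvenSubalgebra (orbSet ({FermionTorus.ofTorusSite (![0, 0] : TorusSite 2 (4 * q))} : Finset (FermionTorus 2 (4 * q)))) :=
      numberOp_mem_carEvenSubalgebra (mem_orbSet.2 (Finset.mem_singleton_self _))
    have hSP : ∀ s t : Finset (Orb (FermionTorus 2 (4 * q))),
        (fun s => s.card = 2 * ⌊(1 - (1 - 7 / 8 : ℝ)) * ((4 * q : ℕ) : ℝ) ^ 2 / 2⌋₊ ∧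
            2 * (s.filter fun i => (ofLex i).2 = 0).card = 2 * ⌊(1 - (1 - 7 / 8 : ℝ)) * ((4 * q : ℕ) : ℝ) ^ 2 / 2⌋₊) s →
        ¬ (fun s => s.card = 2 * ⌊(1 - (1 - 7 / 8 : ℝ)) * ((4 * q : ℕ) : ℝ) ^ 2 / 2⌋₊ ∧
            2 * (s.filter fun i => (ofLex i).2 = 0).card = 2 * ⌊(1 - (1 - 7 / 8 : ℝ)) * ((4 * q : ℕ) : ℝ) ^ 2 / 2⌋₊) t →
        (numberOp (FermionTorus.ofTorusSite (![0, 0] : TorusSite 2 (4 * q))) 0 :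
            Matrix (Finset (Orb (FermionTorus 2 (4 * q)))) (Finset (Orb (FermionTorus 2 (4 * q)))) ℂ) s t = 0 ∧
          (numberOp (FermionTorus.ofTorusSite (![0, 0] : TorusSite 2 (4 * q))) 0 :
            Matrix (Finset (Orb (FermionTorus 2 (4 * q)))) (Finset (Orb (FermionTorus 2 (4 * q)))) ℂ) t s = 0 := by
      intro s t hs ht
      have hst : s ≠ t := fun e => ht (e ▸ hs)
      exact ⟨numberOp_apply_of_ne hst _ _, numberOp_apply_of_ne hst.symm _ _⟩
    have hdist : ∀ x ∈ ({FermionTorus.ofTorusSite (![0, 0] : TorusSite 2 (4 * q))} : Finset (FermionTorus 2 (4 * q))),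
        q ≤ torusDist x.toTorusSite ![(((4 * q) / 2 : ℕ) : ZMod (4 * q)), 0] ∧
          q ≤ torusDist x.toTorusSite ![(((4 * q) / 2 : ℕ) : ZMod (4 * q)) - 1, 0] := by
      intro x hx
      rw [Finset.mem_singleton] at hx
      rw [hx]
      have h0 : (FermionTorus.toTorusSite (FermionTorus.ofTorusSite (![0, 0] : TorusSite 2 (4 * q))) 0).valMinAbs.natAbs ≤ 0 := by
        rw [FermionTorus.toTorusSite_ofTorusSite, Matrix.cons_val_zero, ZMod.valMinAbs_zero, Int.natAbs_zero]
      have hd := farBond_dist_of_mem_collar (4 * q) h0 (0 : ZMod (4 * q))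
      exact ⟨by omega, by omega⟩
    have hj := h (4 * q) (by omega) _ _ hA hSP (((4 * q) / 2 : ℕ) : ZMod (4 * q)) 0 q hdist
    have hj' := (norm_densityCov_sector7o8_eq q (by omega) U).symm.le.trans hj
    rw [Finset.card_singleton, Nat.cast_one, one_pow, mul_one] at hj'
    have hn : ‖(numberOp (FermionTorus.ofTorusSite (![0, 0] : TorusSite 2 (4 * q))) 0 :
        Matrix (Finset (Orb (FermionTorus 2 (4 * q)))) (Finset (Orb (FermionTorus 2 (4 * q)))) ℂ)‖ ≤ 1 :=
      norm_le_of_subsingleton (norm_numberOp_le_one _ _)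
    have hE : 0 < Real.exp (-(q : ℝ) / ξ) := Real.exp_pos _
    have hj'' : 63 / (256 * (16 * (q : ℝ) ^ 2 - 1)) ≤ |C| * Real.exp (-(q : ℝ) / ξ) := by
      refine hj'.trans ?_
      calc C * ‖(numberOp (FermionTorus.ofTorusSite (![0, 0] : TorusSite 2 (4 * q))) 0 :
              Matrix (Finset (Orb (FermionTorus 2 (4 * q)))) (Finset (Orb (FermionTorus 2 (4 * q)))) ℂ)‖ *
              Real.exp (-(q : ℝ) / ξ)
          ≤ |C| * ‖(numberOp (FermionTorus.ofTorusSite (![0, 0] : TorusSite 2 (4 * q))) 0 :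
              Matrix (Finset (Orb (FermionTorus 2 (4 * q)))) (Finset (Orb (FermionTorus 2 (4 * q)))) ℂ)‖ *
              Real.exp (-(q : ℝ) / ξ) := by gcongr; exact le_abs_self C
        _ ≤ |C| * 1 * Real.exp (-(q : ℝ) / ξ) := by gcongr
        _ = |C| * Real.exp (-(q : ℝ) / ξ) := by rw [mul_one]
    have hq1 : (1 : ℝ) ≤ q := by exact_mod_cast (show 1 ≤ q by omega)
    have hden : (0 : ℝ) < 256 * (16 * (q : ℝ) ^ 2 - 1) := by nlinarith
    have hexp : Real.exp (-(1 / ξ * q)) = Real.exp (-(q : ℝ) / ξ) := by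
      congr 1
      ring
    rw [hexp]
    rw [div_le_iff₀ hden] at hj''
    nlinarith [hj'', mul_nonneg (abs_nonneg C) hE.le, hq1]
  have hlim := tendsto_const_mul_pow_mul_exp_neg (|C| * 4096 / 63) 2 (κ := 1 / ξ) (by positivity)
  obtain ⟨q, hq⟩ := ((hlim.eventually (gt_mem_nhds zero_lt_one)).and (eventually_ge_atTop (L₀ + 1))).exists
  exact absurd (key q hq.2) (not_le.2 hq.1)

end Torus

end Summit.Ventures.CertifiedManyBodySolver.Theorems.TcThermcert1.CanonicalDensityPlateau

end
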